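import Summits.HubbardSuperconductivity.HubbardSuperconductivity.Theses.PolyaSchurPairBoson
import Summits.AtomisticToContinuum.BoseEinsteinCondensation.Theorems.BECStronglyRayleighGroundStateStability

/-!
# Route `PolyaSchurPairBoson`, crux `GroundStateStability` (stmt-HubbardSuperconductivity-10289)

The Pólya–Schur / Lee–Yang stability engine of the bosonic route: for the ferromagnetic spin-½ XXZ
model `xxzHamiltonian 1 G (−1) Δ` (`|Δ| ≤ 1`) on a finite connected graph with a real site field, the
amplitudes of the entrywise-nonnegative sector ground vector generate a STABLE multi-affine polynomial
(no zeros in the product of upper half-planes). The item is stated VERBATIM as the BEC route's crux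
`stmt-AtomisticToContinuum-9672` (`BECStronglyRayleigh.GroundStateStability`), which is proved in the
tree (`Summit.AtomisticToContinuum.BoseEinsteinCondensation.Theorems.GroundStateStability_proof`,
`Theorems/BECStronglyRayleighGroundStateStability.lean`, with its Euler-gate / cone-selection /
spectral-mapping chain); the two propositions are syntactically equal (`Iff.rfl`), so the proof
transfers.

Sources: J. Borcea, P. Brändén, Invent. Math. 177 (2009) 541 (Pólya–Schur programme); T. D. Lee,
C. N. Yang, Phys. Rev. 87 (1952) 410; the BEC route's landed proof. No definition is introduced.
-/

set_option linter.dupNamespace false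

namespace Summit.HubbardSuperconductivity.HubbardSuperconductivity.Theorems.PolyaSchurPairBoson

open Summit.HubbardSuperconductivity.HubbardSuperconductivity.Theses.PolyaSchurPairBoson

/-- The Hubbard-route crux and the BEC-route crux are one proposition. [folklore] -/
theorem groundStateStability_iff_bec :
    GroundStateStability ↔
      Summit.AtomisticToContinuum.BoseEinsteinCondensation.Theses.BECStronglyRayleigh.GroundStateStability :=
  Iff.rfl

/-- **`GroundStateStability` holds** (route `PolyaSchurPairBoson`, crux `stmt-HubbardSuperconductivity-10289`):
transferred from the landed BEC-route theorem `GroundStateStability_proof` (Pólya–Schur stability of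
the XXZ sector ground-vector polynomial). Borcea–Brändén, Invent. Math. 177 (2009) 541. [folklore] -/
theorem groundStateStability_proof : GroundStateStability :=
  groundStateStability_iff_bec.mpr
    Summit.AtomisticToContinuum.BoseEinsteinCondensation.Theorems.GroundStateStability_proof

end Summit.HubbardSuperconductivity.HubbardSuperconductivity.Theorems.PolyaSchurPairBoson
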